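import Literature.Computability.AlgebraicComplexity.WeightInitialSubspace
import HarnessLib

/-!
# Lowering unipotent maps on a graded coordinate space (support for the Borel-fixed normal form)

Topic `Literature/Computability/AlgebraicComplexity`. Third layer over `GradedInitialSubspace.lean`
(pieces `inPart`, counts) and `WeightInitialSubspace.lean` (the torus limit `WtInit.stage`), written
for the Borel-fixed border apolarity lower bounds of Conner–Harper–Landsberg 2023 (§2.4–§2.5: "we
may assume that `E_{ijk}` is Borel fixed"). For a coordinate space `K^σ` graded by `deg : σ → ℤ`
(the weights of a one-parameter torus) this file fixes the elementary vocabulary of the UNIPOTENT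
half of a Borel subgroup, with no algebraic groups:

* `WtInit.IsGraded E` — `E` contains the weight components of its elements (torus fixed);
* `WtInit.Vlt deg d = V_{< d}` (complement of `Vge`), `WtInit.IsHomog deg d φ`;
* `WtInit.IsLowering deg u` — `u φ - φ ∈ V_{< d}` for `φ` homogeneous of degree `d`: the unipotent
  root elements `exp(X_α)` of the roots `α` NEGATIVE on the grading torus (so `u = 1 + N` with `N`
  strictly lowering degrees);
* `WtInit.IsLowering.map_mem_Vlt` (`u V_{<d} ⊆ V_{<d}`), `WtInit.IsLowering.injective`;
* `WtInit.sum_projDeg_eq`, `WtInit.le_of_projDeg_mem`, `WtInit.IsGraded.projLt_mem`,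
  `WtInit.IsGraded.sub_projLt_mem_Fge` — graded subspaces contain the truncations of their elements.

The potential argument that turns these into the Borel-fixed normal form is
`BorderApolarityBorelFixed.lean`. Everything PROVED. [folklore]

## References

* A. Conner, A. Harper, J. M. Landsberg, *New lower bounds for matrix multiplication and `det₃`*,
  Forum Math. Pi 11 (2023) e17 = arXiv:1911.07981, §2.4–§2.5 (Borel and torus fixed subspaces,
  weight vectors, raising operators). [ConnerHarperLandsberg2023]
-/

noncomputable section

open scoped BigOperators

namespace Literature.Computability.AlgebraicComplexity

namespace WtInit

universe u v

variable {K : Type u} [Field K] {σ : Type v} (deg : σ → ℤ)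

/-! ## Graded subspaces, strictly lower parts, lowering maps -/

/-- A subspace is GRADED (torus fixed) when it contains the weight components of its elements.
[cite: ConnerHarperLandsberg2023, §2.5] -/
def IsGraded (E : Submodule K (σ → K)) : Prop := ∀ d, ∀ x ∈ E, projDeg deg d x ∈ E

/-- `V_{< d}`: vectors with no coordinate of degree `≥ d`. [folklore] -/
def Vlt (d : ℤ) : Submodule K (σ → K) where
  carrier := {φ | ∀ s, d ≤ deg s → φ s = 0}
  add_mem' {φ ψ} hφ hψ s hs := by simp [hφ s hs, hψ s hs]
  zero_mem' s _ := rfl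
  smul_mem' c {φ} hφ s hs := by simp [hφ s hs]

/-- Membership in `V_{< d}`. [folklore] -/
theorem mem_Vlt {d : ℤ} {φ : σ → K} : φ ∈ Vlt deg d ↔ ∀ s, d ≤ deg s → φ s = 0 := Iff.rfl

/-- `V_{< d}` decreases as `d` decreases. [folklore] -/
theorem Vlt_mono {d d' : ℤ} (h : d ≤ d') : (Vlt deg d : Submodule K (σ → K)) ≤ Vlt deg d' :=
  fun _ hφ s hs => hφ s (h.trans hs)

/-- `V_{< d} ∩ V_{≥ d} = 0`. [folklore] -/
theorem eq_zero_of_mem_Vlt_of_mem_Vge {d : ℤ} {φ : σ → K} (h1 : φ ∈ Vlt deg d) (h2 : φ ∈ Vge deg d) :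
    φ = 0 := by
  funext s
  rcases lt_or_ge (deg s) d with h | h
  · exact (mem_Vge deg).1 h2 s h
  · exact h1 s h

/-- `projLt d φ ∈ V_{< d}`. [folklore] -/
theorem projLt_mem_Vlt (d : ℤ) (φ : σ → K) : projLt deg d φ ∈ Vlt deg d := by
  intro s hs
  simp [projLt, not_lt.2 hs]

/-- `φ - projLt d φ ∈ V_{≥ d}` (the part of degree `≥ d`). [folklore] -/
theorem sub_projLt_mem_Vge (d : ℤ) (φ : σ → K) : φ - projLt deg d φ ∈ Vge deg d := by
  refine (mem_Vge deg).2 fun s hs => ?_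
  simp [projLt, hs]

/-- A vector HOMOGENEOUS of degree `d`: all its non-zero coordinates have degree `d`. [folklore] -/
def IsHomog (d : ℤ) (φ : σ → K) : Prop := ∀ s, φ s ≠ 0 → deg s = d

/-- `projDeg d φ` is homogeneous of degree `d`. [folklore] -/
theorem isHomog_projDeg (d : ℤ) (φ : σ → K) : IsHomog deg d (projDeg deg d φ) := by
  intro s hs
  by_contra h
  exact hs (by simp [projDeg, h])

/-- A **lowering unipotent map**: `u φ - φ` lies strictly below the degree of a homogeneous `φ`
(the unipotent root elements of roots that are negative on the grading torus).
[cite: ConnerHarperLandsberg2023, §2.5] -/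
def IsLowering (u : (σ → K) →ₗ[K] (σ → K)) : Prop :=
  ∀ d φ, IsHomog deg d φ → u φ - φ ∈ Vlt deg d

variable {deg}

section Lowering

variable {u : (σ → K) →ₗ[K] (σ → K)} (hu : IsLowering deg u)
include hu

/-- A homogeneous vector of degree `< d` is mapped into `V_{< d}`. [folklore] -/
theorem IsLowering.map_mem_Vlt_of_isHomog {d e : ℤ} (hed : e < d) {φ : σ → K}
    (hφ : IsHomog deg e φ) : u φ ∈ Vlt deg d := by
  have h1 : u φ - φ ∈ Vlt deg d := Vlt_mono deg hed.le (hu e φ hφ)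
  have h2 : φ ∈ Vlt deg d := fun s hs => by
    by_contra h
    have := hφ s h
    omega
  have : u φ = (u φ - φ) + φ := by abel
  rw [this]
  exact Submodule.add_mem _ h1 h2

variable [Fintype σ]

omit hu in
/-- Decomposition of a vector of `V_{< d}` into its homogeneous components of degrees `< d`, over
the finite set of degrees that occur. [folklore] -/
theorem sum_projDeg_eq_of_mem_Vlt [DecidableEq ℤ] {d : ℤ} {φ : σ → K} (hφ : φ ∈ Vlt deg d) :
    ∑ e ∈ (Finset.univ.image deg).filter (· < d), projDeg deg e φ = φ := by
  funext s
  rw [Finset.sum_apply]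
  rcases lt_or_ge (deg s) d with h | h
  · rw [Finset.sum_eq_single (deg s)]
    · simp
    · intro e _ hne
      simp [projDeg, Ne.symm hne]
    · intro hs
      exact absurd (Finset.mem_filter.2 ⟨Finset.mem_image_of_mem _ (Finset.mem_univ s), h⟩) hs
  · rw [hφ s h]
    refine Finset.sum_eq_zero fun e he => ?_
    have he' := (Finset.mem_filter.1 he).2
    simp [projDeg, show deg s ≠ e by omega]

/-- **A lowering map preserves every `V_{< d}`.** [folklore] -/
theorem IsLowering.map_mem_Vlt {d : ℤ} {φ : σ → K} (hφ : φ ∈ Vlt deg d) : u φ ∈ Vlt deg d := by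
  classical
  rw [← sum_projDeg_eq_of_mem_Vlt hφ, map_sum]
  refine Submodule.sum_mem _ fun e he => ?_
  exact hu.map_mem_Vlt_of_isHomog (Finset.mem_filter.1 he).2 (isHomog_projDeg deg e φ)

/-- **A lowering map is injective** (its top-degree part is the identity). [folklore] -/
theorem IsLowering.injective : Function.Injective u := by
  classical
  rw [← LinearMap.ker_eq_bot, Submodule.eq_bot_iff]
  intro φ hφ
  rw [LinearMap.mem_ker] at hφ
  by_contra hne
  -- the top degree `d` among the non-zero coordinates of `φ`
  have hne' : ∃ s, φ s ≠ 0 := by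
    by_contra h
    push Not at h
    exact hne (funext h)
  obtain ⟨s₀, hs₀⟩ := hne'
  set D := (Finset.univ.filter fun s => φ s ≠ 0).image deg with hD
  have hDne : D.Nonempty :=
    ⟨deg s₀, Finset.mem_image_of_mem _ (Finset.mem_filter.2 ⟨Finset.mem_univ _, hs₀⟩)⟩
  set d := D.max' hDne with hd
  -- `φ = φ_d + φ_{<d}` with `φ_d ≠ 0` homogeneous of degree `d`
  have hlow : φ - projDeg deg d φ ∈ Vlt deg d := by
    intro s hs
    simp only [Pi.sub_apply, projDeg_apply]
    by_cases h : deg s = d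
    · simp [h]
    · rw [if_neg h, sub_zero]
      by_contra hφs
      have hmem : deg s ∈ D :=
        Finset.mem_image_of_mem _ (Finset.mem_filter.2 ⟨Finset.mem_univ _, hφs⟩)
      have := D.le_max' _ hmem
      omega
  have htop : projDeg deg d φ ≠ 0 := by
    obtain ⟨s₁, hs₁, hds₁⟩ := Finset.mem_image.1 (D.max'_mem hDne)
    intro h
    have := congr_fun h s₁
    simp only [projDeg_apply, Pi.zero_apply] at this
    rw [if_pos (hds₁.trans hd.symm)] at this
    exact (Finset.mem_filter.1 hs₁).2 this
  -- `0 = u φ = φ_d + (u φ_d - φ_d) + u φ_{<d}`, the last two in `V_{<d}`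
  have h1 : u (projDeg deg d φ) - projDeg deg d φ ∈ Vlt deg d := hu d _ (isHomog_projDeg deg d φ)
  have h2 : u (φ - projDeg deg d φ) ∈ Vlt deg d := hu.map_mem_Vlt hlow
  have hsum : projDeg deg d φ =
      -(u (projDeg deg d φ) - projDeg deg d φ) - u (φ - projDeg deg d φ) := by
    have h0 : u (projDeg deg d φ) + u (φ - projDeg deg d φ) = 0 := by
      rw [← map_add, add_sub_cancel, hφ]
    have : -(u (projDeg deg d φ) - projDeg deg d φ) - u (φ - projDeg deg d φ) =
        projDeg deg d φ - (u (projDeg deg d φ) + u (φ - projDeg deg d φ)) := by abel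
    rw [this, h0, sub_zero]
  have hmem : projDeg deg d φ ∈ Vlt deg d := by
    rw [hsum]
    exact Submodule.sub_mem _ (Submodule.neg_mem _ h1) h2
  have hge : projDeg deg d φ ∈ Vge deg d := (mem_Vge deg).2 fun s hs => by
    simp [projDeg, show deg s ≠ d by omega]
  exact htop (eq_zero_of_mem_Vlt_of_mem_Vge deg hmem hge)

end Lowering

/-! ## Graded subspaces contain the truncations of their elements -/

section Graded

variable [Fintype σ]

variable (deg) in
/-- Decomposition of any vector into its homogeneous components over the degrees that occur.
[folklore] -/
theorem sum_projDeg_eq [DecidableEq ℤ] (φ : σ → K) :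
    ∑ e ∈ Finset.univ.image deg, projDeg deg e φ = φ := by
  funext s
  rw [Finset.sum_apply, Finset.sum_eq_single (deg s)]
  · simp
  · intro e _ hne
    simp [projDeg, Ne.symm hne]
  · intro hs
    exact absurd (Finset.mem_image_of_mem _ (Finset.mem_univ s)) hs

variable (deg) in
/-- A subspace containing every homogeneous component of the elements of `E` contains `E`.
[folklore] -/
theorem le_of_projDeg_mem {E F : Submodule K (σ → K)}
    (h : ∀ d, ∀ x ∈ E, projDeg deg d x ∈ F) : E ≤ F := by
  classical
  intro x hx
  rw [← sum_projDeg_eq deg x]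
  exact Submodule.sum_mem _ fun e _ => h e x hx

variable {E : Submodule K (σ → K)} (hE : IsGraded deg E)
include hE

/-- A graded subspace contains `projLt d x` for its elements `x`. [folklore] -/
theorem IsGraded.projLt_mem (d : ℤ) {x : σ → K} (hx : x ∈ E) : projLt deg d x ∈ E := by
  classical
  rw [← sum_projDeg_eq_of_mem_Vlt (projLt_mem_Vlt deg d x)]
  refine Submodule.sum_mem _ fun e he => ?_
  have he' := (Finset.mem_filter.1 he).2
  have : projDeg deg e (projLt deg d x) = projDeg deg e x := by
    funext s
    simp only [projDeg_apply, projLt, LinearMap.coe_mk, AddHom.coe_mk]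
    by_cases h : deg s = e
    · rw [if_pos h, if_pos h, if_pos (h ▸ he')]
    · rw [if_neg h, if_neg h]
  rw [this]
  exact hE e x hx

/-- A graded subspace contains the truncations `x - projLt d x ∈ E ∩ V_{≥ d}` of its elements.
[folklore] -/
theorem IsGraded.sub_projLt_mem_Fge (d : ℤ) {x : σ → K} (hx : x ∈ E) :
    x - projLt deg d x ∈ Fge deg E d :=
  ⟨Submodule.sub_mem _ hx (hE.projLt_mem d hx), sub_projLt_mem_Vge deg d x⟩

end Graded

end WtInit

end Literature.Computability.AlgebraicComplexity

end
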